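import Literature.AnabelianGeometry.EtaleTheta.TemperedFrobenioidCor38SubLinearNegative
import Literature.AlgebraicGeometry.Frobenioids.GroupLikeStandardExample
import HarnessLib

/-!
# [EtTh] Cor. 3.8, proof row `PreservesPreSteps` (F-2809) HOLDS at the admissible degree↔dilation swap `AffDil.hyp`
# (the record that refutes the closure of `PreservesLinear`, F-2815) — a kernel instance datum, proof-only

S. Mochizuki, *The étale theta function and its Frobenioid-theoretic manifestations*, Publ. RIMS **45** (2009), Cor. 3.8
proof, PDF p. 81 l. 2–3: "by [Mzk17], Theorem 3.4, (ii) … it follows that `Ψ` preserves pre-steps"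
[cite: MochizukiEtTh2009, Cor 3.8 p.81]; S. Mochizuki, *The geometry of Frobenioids I* (2008), Def. 1.2 (iii) p. 22 (pre-steps =
linear base-isomorphisms), §0 p. 14 (isomorphisms of a one-object category) [cite: MochizukiFrdI2008, Def. 1.2 (iii) p.22].

abc-iut cell, seat abc-iut-w4-d097 (gen 8).  PROOF-ONLY companion (0 definitions) of abc-iut-f-133's
`TemperedFrobenioidCor38SubLinearNegative.lean` (p455772: the universal closure of `Cor38Hyp.PreservesLinear`, FACT-LIST
F-2815, is FALSE at `AffDil.hyp`, the degree↔dilation swap `σ : (d, (n,u), z, (k,·)) ↦ (n, (d,k), (n/d)·z, (u,·))` over the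
FSMFF base `SingleObj Aff⁺(ℤ)`).  That file records in prose that pre-steps are `σ`-stable; THIS file proves it in the kernel:
a pre-step (`deg_Fr = 1`, `Base` an isomorphism, i.e. `expo (Base) = 1` in `Aff⁺(ℤ)`) goes to `(deg_Fr = expo = 1, Base = (1, k))`,
a translation, which is invertible — `AffDil.swap_preservesMor_isPreStep`; since `σ` is its own inverse
(`AffDil.swapEquiv`), **`AffDil.preservesPreSteps_hyp : AffDil.hyp.PreservesPreSteps`**.  Reading (cell rule R5): an
INSTANCE form of row F-2809 at the one record of the tree whose `Ψ` moves Frobenius degrees — so the bare closure of F-2809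
(the only undecided closure of the Cor. 3.8 proof-row cluster after p447778 / p448239 / p455772) is NOT settled by the
degree↔dilation mechanism; its instance forms of record (`Cor38Hyp.preservesPreSteps_of_thm34ii`, abc-iut-f-001's
`preservesPreSteps_treeCatVocab`) are untouched.  HONEST FRAMING: bookkeeping about OUR typed toy record; nothing here bears on
the disputed [IUTchIII] Cor. 3.12; no side taken; typed ≠ proved.
-/

noncomputable section

namespace Literature.AnabelianGeometry.EtaleTheta

open CategoryTheory Opposite Literature.AlgebraicGeometry.Frobenioids Literature.AlgebraicGeometry.Frobenioids.IntAffine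

namespace AffDil

/-- In the base `SingleObj Aff⁺(ℤ)` an isomorphism has `expo = 1` (isomorphisms = units = translations).
[cite: MochizukiFrdI2008, §0 p.14] -/
theorem expo_eq_one_of_isIso {A B : Literature.AlgebraicGeometry.Frobenioids.IntAffine.D} (f : A ⟶ B) [IsIso f] :
    Literature.AlgebraicGeometry.Frobenioids.IntAffine.expo f = 1 :=
  (isUnit_iff_expo_eq_one _).1 ((SingleObj.isIso_iff_isUnit f).1 inferInstance)

/-- An arrow of the base with `expo = 1` is an isomorphism. [cite: MochizukiFrdI2008, §0 p.14] -/
theorem isIso_of_expo_eq_one {A B : Literature.AlgebraicGeometry.Frobenioids.IntAffine.D} (f : A ⟶ B)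
    (h : Literature.AlgebraicGeometry.Frobenioids.IntAffine.expo f = 1) : IsIso f :=
  (SingleObj.isIso_iff_isUnit f).2 ((isUnit_iff_expo_eq_one _).2 h)

/-- **The degree↔dilation swap PRESERVES PRE-STEPS**: for a pre-step `φ` (`deg_Fr φ = 1`, `Base φ` an isomorphism, so
`expo (Base φ) = 1`), `σ(φ)` has `deg_Fr = expo (Base φ) = 1` and `Base = (deg_Fr φ, k) = (1, k)`, a translation, hence an
isomorphism. [cite: MochizukiEtTh2009, Cor 3.8 p.81] -/
theorem swap_preservesMor_isPreStep :
    PreFrobenioidData.PreservesMor Literature.AnabelianGeometry.EtaleTheta.AffDil.swap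
      Literature.AnabelianGeometry.EtaleTheta.AffDil.C.opsData.IsPreStep Literature.AnabelianGeometry.EtaleTheta.AffDil.C.opsData.IsPreStep := by
  rintro X Y φ ⟨hlin, hiso⟩
  have hd : ModelFrobenioid.degFr φ = 1 := hlin
  have he : expo (ModelFrobenioid.baseMap φ) = 1 := @expo_eq_one_of_isIso _ _ _ hiso
  refine ⟨?_, ?_⟩
  · change expo (ModelFrobenioid.baseMap φ) = 1
    exact he
  · change IsIso (show X.base ⟶ Y.base from IntAffine.mk (ModelFrobenioid.degFr φ) (Multiplicative.toAdd (kOf φ)))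
    rw [hd]
    exact isIso_of_expo_eq_one _ (expo_mk _ _)

/-- **Row C38-L02a / F-2809 `PreservesPreSteps` HOLDS at `AffDil.hyp`** (both `Ψ` and `Ψ⁻¹` are the swap).
[cite: MochizukiEtTh2009, Cor 3.8 p.81] -/
theorem preservesPreSteps_hyp : Literature.AnabelianGeometry.EtaleTheta.AffDil.hyp.PreservesPreSteps :=
  ⟨swap_preservesMor_isPreStep, swap_preservesMor_isPreStep⟩

/-- At the same record the two degree-sensitive rows separate: `PreservesLinear` FAILS (f-133, p455772) while
`PreservesPreSteps` HOLDS — the swap moves the degree only of arrows whose base is NOT an isomorphism.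
[cite: MochizukiEtTh2009, Cor 3.8 p.81] -/
theorem preservesPreSteps_and_not_preservesLinear_hyp :
    Literature.AnabelianGeometry.EtaleTheta.AffDil.hyp.PreservesPreSteps ∧ ¬ Literature.AnabelianGeometry.EtaleTheta.AffDil.hyp.PreservesLinear :=
  ⟨preservesPreSteps_hyp, not_preservesLinear_hyp⟩

end AffDil

end Literature.AnabelianGeometry.EtaleTheta

end
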